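import Mathlib
import HarnessLib
import Literature.Computability.AlgebraicComplexity.AsymptoticSpectrum
import Literature.Computability.AlgebraicComplexity.BorderRankCW
import Literature.Computability.AlgebraicComplexity.BILPS19MinrankInvarianceProofs
import Summits.MatrixMultiplication.MatrixMultiplication.Theorems.OutsiderSandwichPolystableRigidity
import Summits.MatrixMultiplication.MatrixMultiplication.Theorems.OutsiderSandwichCwTwoPowPolystable
import Summits.MatrixMultiplication.MatrixMultiplication.Theorems.OutsiderSandwichUnitKroneckerRigidity

/-!
# OutsiderSandwich — the minrank gap: no exchange rung `p/q`, `p < q`, has a witness at ANY finite level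
(lens-4 g33; settles handoff P32-b of NODE-g32 for all rungs and all levels at once)

Route-independent support kernel (no `Theses` import, no new definitions).

The g31/g32 exchange ladder reads rung `p/q` as the asymptotic restriction
`⟨3^q⟩ ⊠ ⟨2^p,2^p,2^p⟩ ≲ ⟨4^p⟩ ⊠ cw₂^{⊠q}`; at level `L` both sides are cubic tensors of the SAME format
`3^{qL} 4^{pL}`.  g32 proved (Kempf–Ness, `exists_smul_sl3_eq_of_degeneratesTo`) that a DEGENERATION between
the two level-`L` tensors is an isomorphism up to a scalar, and excluded the level-one witness of the first
open rung `1/2` by a hand computation of slice ranks (memo only).  This file makes the slice-rank invariant a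
theorem, in the tree's BILPS vocabulary (`contract3`, `minrankSet` = the minrank variety `𝓜_r` of
Bläser–Ikenmeyer–Lysikov–Pandey–Schreyer, Def. 13/15):

* `two_pow_le_rank_contract3_unitKronecker_cwTwoPow` — EVERY non-zero slice `∑ₐ xₐ (⟨n⟩ ⊠ cw₂^{⊠N})ₐ` has
  rank `≥ 2^N` (proof: a support word of minimal weight carries a `2^N × 2^N` scalar submatrix), i.e.
  `⟨n⟩ ⊠ cw₂^{⊠N} ∉ 𝓜_r` for `r < 2^N` (`not_mem_minrankSet_unitKronecker_cwTwoPow`);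
* `mem_minrankSet_relabel_unitKronecker_matMul` — `⟨n'⟩ ⊠ ⟨m,m,m⟩ ∈ 𝓜_m` (a coordinate slice is an
  `m`-term rank-one sum), for every relabelling of its format;
* `mem_minrankSet_of_eq_smul_actTensor` — `𝓜_r` is invariant under `ℂˣ × SL³` (BILPS Lemma 18 plus scalars);
* **`unitKronecker_cwTwoPow_not_degeneratesTo_matMul`** — for `m < 2^N` and EVERY bijection `e` of the formats,
  `⟨n⟩ ⊠ cw₂^{⊠N} ⋭ e^*(⟨n'⟩ ⊠ ⟨m,m,m⟩)` (orbit-closure degeneration).  Corollaries: no exchange rung `p/q`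
  with `p < q` has a degeneration witness at any finite level `L ≥ 1` (`rung_not_degeneratesTo_of_lt`), in
  particular the first open rung `1/2` at level one (`rungHalf_not_degeneratesTo_levelOne`, the g32 hand
  claim) and the cells `cw₂^{⊠4}` vs `⟨9⟩ ⊠ ⟨3,3,3⟩`, `cw₂^{⊠6}` vs `⟨27,27,27⟩`-type packings.

Honest tag: `ω`-free NEGATIVE CALIBRATION of the ladder (the rungs are intrinsically asymptotic: the `o(L)`
slack in `≲` is essential, exactly as for the perfection cells of `CwTwoNoExactPerfection`); it does not
move `LaserMergeOptimal`.  Reach of the invariant: `minrank(⟨n⟩ ⊠ cw₂^{⊠N}) = 2^N` is attained (word `0^N`),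
so slope-`≥ 1` pairs such as `⟨4⟩ ⊠ cw₂` vs `⟨3⟩ ⊠ ⟨2,2,2⟩` (`m = 2 = 2^N`) are NOT separated by it.

References: [cite: BlaserIkenmeyerLysikovPandeySchreyer2019, Def. 13, Def. 15, Lemma 18];
[cite: KempfNess1979, Thm. 0.2]; [cite: BurgisserIkenmeyer2017, §4.2]; [cite: Strassen1988, Thm. 3.8];
[cite: CoppersmithWinograd1990, §6].
-/

noncomputable section

open scoped BigOperators Matrix

open Literature.Computability.AlgebraicComplexity

namespace Summit.MatrixMultiplication.MatrixMultiplication.Theorems.OutsiderSandwichMinrankGap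

open OutsiderSandwichPolystableRigidity OutsiderSandwichCwTwoPowPolystable
  OutsiderSandwichUnitKroneckerRigidity

/-! ## §1  Slices under relabelling, scalars and `ℂˣ × SL³` -/

section Invariance

/-- Slices of a relabelled tensor are the relabelled slices. [folklore] -/
theorem contract3_relabel {F : Type*} [Field F] {ι ι' : Type*} [Fintype ι] [Fintype ι']
    (e : ι' ≃ ι) (T : ι → ι → ι → F) (x : ι → F) :
    contract3 (fun a b c => T (e a) (e b) (e c)) (fun a => x (e a)) = (contract3 T x).submatrix e e := by
  ext b c
  simp only [contract3_apply, Matrix.submatrix_apply]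
  exact e.sum_comp (fun a => x a * T a (e b) (e c))

/-- Slices are linear in the tensor: `(c • T) x = c • (T x)`. [folklore] -/
theorem contract3_smul {F : Type*} [Field F] {ι κ μ : Type*} [Fintype ι] (c : F)
    (T : ι → κ → μ → F) (x : ι → F) : contract3 (c • T) x = c • contract3 T x := by
  ext b d
  simp only [contract3_apply, Matrix.smul_apply, Pi.smul_apply, smul_eq_mul, Finset.mul_sum]
  exact Finset.sum_congr rfl fun _ _ => by ring

/-- **`𝓜_r` is `ℂˣ × SL³`-invariant** (BILPS Lemma 18 with scalars): if `w₁ = c • (s₁ ⊗ s₂ ⊗ s₃)·w₀` with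
`c ≠ 0`, `sᵢ ∈ SL`, and `w₁` has a non-zero slice of rank `≤ r`, then so has `w₀` (slice identity
`(w₁)ξ = c · s₂ · (w₀)(ξ s₁) · s₃ᵀ`). [cite: BlaserIkenmeyerLysikovPandeySchreyer2019, Lemma 18] -/
theorem mem_minrankSet_of_eq_smul_actTensor {ι : Type} [Fintype ι] [DecidableEq ι] {r : ℕ} {c : ℂ}
    (hc : c ≠ 0) (s : Matrix.SpecialLinearGroup ι ℂ × Matrix.SpecialLinearGroup ι ℂ ×
      Matrix.SpecialLinearGroup ι ℂ) {w₀ w₁ : ι → ι → ι → ℂ}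
    (h : w₁ = c • actTensor (s.1 : Matrix ι ι ℂ) (s.2.1 : Matrix ι ι ℂ) (s.2.2 : Matrix ι ι ℂ) w₀)
    (h₁ : w₁ ∈ (minrankSet ℂ r : Set (ι → ι → ι → ℂ))) :
    w₀ ∈ (minrankSet ℂ r : Set (ι → ι → ι → ℂ)) := by
  obtain ⟨ξ, hξ, hrank⟩ := h₁
  have hU₁ : IsUnit (s.1 : Matrix ι ι ℂ) :=
    (Matrix.isUnit_iff_isUnit_det _).mpr (by rw [Matrix.SpecialLinearGroup.det_coe]; exact isUnit_one)
  refine ⟨Matrix.vecMul ξ (s.1 : Matrix ι ι ℂ), fun h0 => hξ ?_, ?_⟩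
  · exact Matrix.vecMul_injective_iff_isUnit.mpr hU₁ (h0.trans (Matrix.zero_vecMul _).symm)
  · have key : contract3 w₁ ξ = (c • (s.2.1 : Matrix ι ι ℂ)) *
        contract3 w₀ (Matrix.vecMul ξ (s.1 : Matrix ι ι ℂ)) * (s.2.2 : Matrix ι ι ℂ)ᵀ := by
      rw [h, contract3_smul, contract3_actTensor, ← Matrix.smul_mul, ← Matrix.smul_mul]
    have h2 : IsUnit (c • (s.2.1 : Matrix ι ι ℂ)).det := by
      rw [Matrix.det_smul, Matrix.SpecialLinearGroup.det_coe, mul_one]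
      exact isUnit_iff_ne_zero.mpr (pow_ne_zero _ hc)
    have h3 : IsUnit ((s.2.2 : Matrix ι ι ℂ)ᵀ).det := by
      rw [Matrix.det_transpose, Matrix.SpecialLinearGroup.det_coe]; exact isUnit_one
    rw [key, Matrix.rank_mul_eq_left_of_isUnit_det _ _ h3,
      Matrix.rank_mul_eq_right_of_isUnit_det _ _ h2] at hrank
    exact hrank

end Invariance

/-! ## §2  The matrix-multiplication side: `⟨n'⟩ ⊠ ⟨m,m,m⟩ ∈ 𝓜_m` -/

section MatMulSide

/-- A coordinate slice of `⟨n'⟩ ⊠ ⟨m,m,m⟩` (covector `e_{p₀}`, `p₀ = (u, (κ, ν))`) is the rank-`≤ m` matrix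
`∑_μ e_{(u,(κ,μ))} e_{(u,(μ,ν))}ᵀ`. [cite: Blaser2013, §5] -/
theorem rank_contract3_unitKronecker_matMul_single_le {n' m : ℕ} (p₀ : Fin n' × (Fin m × Fin m)) :
    (contract3 (kroneckerTensor (unitTensor ℂ n') (matMulTensor ℂ m m m))
      (fun a => if a = p₀ then 1 else 0)).rank ≤ m := by
  classical
  let P : Matrix (Fin n' × (Fin m × Fin m)) (Fin m) ℂ :=
    fun b μ => if p₀.1 = b.1 ∧ p₀.2.1 = b.2.1 ∧ b.2.2 = μ then 1 else 0
  let Q : Matrix (Fin m) (Fin n' × (Fin m × Fin m)) ℂ :=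
    fun μ c => if p₀.1 = c.1 ∧ μ = c.2.1 ∧ p₀.2.2 = c.2.2 then 1 else 0
  have hPQ : contract3 (kroneckerTensor (unitTensor ℂ n') (matMulTensor ℂ m m m))
      (fun a => if a = p₀ then 1 else 0) = P * Q := by
    ext b c
    simp only [contract3_apply, Matrix.mul_apply]
    rw [Finset.sum_eq_single p₀ (fun a _ ha => by simp [ha]) (by simp),
      Finset.sum_eq_single b.2.2 (fun μ _ hμ => by simp [P, Ne.symm hμ]) (by simp)]
    simp only [if_true, one_mul, kroneckerTensor_apply, unitTensor_apply, matMulTensor, P, Q,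
      ite_zero_mul_ite_zero, mul_one, and_true]
    refine if_congr ⟨?_, ?_⟩ rfl rfl
    · rintro ⟨⟨h1, h2⟩, h3, h4, h5⟩
      exact ⟨⟨h1, h3⟩, h1.trans h2, h4, h5⟩
    · rintro ⟨⟨h1, h3⟩, h2, h4, h5⟩
      exact ⟨⟨h1, h1.symm.trans h2⟩, h3, h4, h5⟩
  rw [hPQ]
  calc (P * Q).rank ≤ P.rank := Matrix.rank_mul_le_left _ _
    _ ≤ Fintype.card (Fin m) := Matrix.rank_le_card_width _
    _ = m := Fintype.card_fin m

/-- **`⟨n'⟩ ⊠ ⟨m,m,m⟩ ∈ 𝓜_m`** for every relabelling of its format (`n', m ≥ 1`: the coordinate covector is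
non-zero). [cite: BlaserIkenmeyerLysikovPandeySchreyer2019, Def. 15] -/
theorem mem_minrankSet_relabel_unitKronecker_matMul {ι' : Type} [Fintype ι'] [DecidableEq ι']
    {n' m : ℕ} (hn' : 0 < n') (hm : 0 < m) (e : ι' ≃ (Fin n' × (Fin m × Fin m))) :
    (fun a b c => kroneckerTensor (unitTensor ℂ n') (matMulTensor ℂ m m m) (e a) (e b) (e c)) ∈
      (minrankSet ℂ m : Set (ι' → ι' → ι' → ℂ)) := by
  classical
  set p₀ : Fin n' × (Fin m × Fin m) := (⟨0, hn'⟩, (⟨0, hm⟩, ⟨0, hm⟩)) with hp₀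
  refine ⟨fun a => if e a = p₀ then 1 else 0, fun h0 => ?_, ?_⟩
  · have := congr_fun h0 (e.symm p₀)
    simp at this
  · have hrel := contract3_relabel e (kroneckerTensor (unitTensor ℂ n') (matMulTensor ℂ m m m))
      (fun a => if a = p₀ then 1 else 0)
    rw [hrel]
    exact (Matrix.rank_submatrix_le _ _ _).trans (rank_contract3_unitKronecker_matMul_single_le p₀)

end MatMulSide

/-! ## §3  The Coppersmith–Winograd side: every non-zero slice of `⟨n⟩ ⊠ cw₂^{⊠N}` has rank `≥ 2^N` -/

section CwSide

/-- Row/column tables for `cw₂ = x₀(y₁z₁+y₂z₂) + x₁(y₀z₁+y₁z₀) + x₂(y₀z₂+y₂z₀)`: for each letter `l` two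
positions `(Y l b, Z l b')`, `b, b' ∈ {0,1}`, on which the `x_l`-slice of `cw₂` is the `2 × 2` identity and
the `x_{l'}`-slices, `l' > l`, vanish. [cite: CoppersmithWinograd1990, §6] -/
theorem cwTwo_tables :
    ∃ Y Z : Fin 3 → Fin 2 → Fin 3,
      (∀ (l : Fin 3) (b b' : Fin 2), cwTensor ℂ 2 l (Y l b) (Z l b') = if b = b' then 1 else 0) ∧
      (∀ (l l' : Fin 3), l < l' → ∀ b b' : Fin 2, cwTensor ℂ 2 l' (Y l b) (Z l b') = 0) := by
  refine ⟨![![1, 2], ![0, 1], ![0, 2]], ![![1, 2], ![1, 0], ![2, 0]], ?_, ?_⟩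
  · intro l b b'
    fin_cases l <;> fin_cases b <;> fin_cases b' <;> simp [cwTensor]
  · intro l l' hll' b b'
    revert hll'
    fin_cases l <;> fin_cases l' <;> fin_cases b <;> fin_cases b' <;> simp [cwTensor]

/-- In a finite set of words over `Fin 3`, a word of minimal weight `∑ₚ aₚ` is coordinatewise exceeded
somewhere by every other word of the set. [folklore] -/
theorem exists_minWeight_word {N : ℕ} (S : Finset (Fin N → Fin 3)) (hS : S.Nonempty) :
    ∃ a ∈ S, ∀ i ∈ S, i ≠ a → ∃ p, a p < i p := by
  classical
  obtain ⟨a, haS, hmin⟩ := S.exists_min_image (fun i : Fin N → Fin 3 => ∑ p, ((i p : ℕ))) hS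
  refine ⟨a, haS, fun i hi hne => ?_⟩
  by_contra hcon
  push Not at hcon
  have hle : ∀ p ∈ (Finset.univ : Finset (Fin N)), ((i p : ℕ)) ≤ (a p : ℕ) := fun p _ => by
    exact_mod_cast hcon p
  have h1 : ∑ p, ((a p : ℕ)) ≤ ∑ p, ((i p : ℕ)) := hmin i hi
  have h2 : ∑ p, ((i p : ℕ)) ≤ ∑ p, ((a p : ℕ)) := Finset.sum_le_sum hle
  have heq := (Finset.sum_eq_sum_iff_of_le hle).mp (le_antisymm h2 h1)
  exact hne (funext fun p => Fin.ext (heq p (Finset.mem_univ p)))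

/-- **Every non-zero slice of `⟨n⟩ ⊠ cw₂^{⊠N}` has rank `≥ 2^N`.**  Pick a block `u₀` and a support word
`a` of minimal weight in it; on the rows `(u₀, (Y aₚ bₚ)ₚ)` and columns `(u₀, (Z aₚ b'ₚ)ₚ)`, `b, b' ∈ {0,1}^N`,
the slice is `x_{(u₀,a)} · 1_{2^N}` (every other support word exceeds `a` in some coordinate, where its
`cw₂`-factor vanishes on the table). [cite: CoppersmithWinograd1990, §6] -/
theorem two_pow_le_rank_contract3_unitKronecker_cwTwoPow {n N : ℕ}
    {x : Fin n × (Fin N → Fin 3) → ℂ} (hx : x ≠ 0) :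
    2 ^ N ≤ (contract3 (kroneckerTensor (unitTensor ℂ n) (kroneckerPow (cwTensor ℂ 2) N)) x).rank := by
  classical
  obtain ⟨⟨u₀, i₀⟩, hi₀⟩ : ∃ a, x a ≠ 0 := by
    by_contra h
    push Not at h
    exact hx (funext h)
  obtain ⟨Y, Z, hdiag, hkill⟩ := cwTwo_tables
  set S : Finset (Fin N → Fin 3) := Finset.univ.filter (fun i => x (u₀, i) ≠ 0) with hS
  obtain ⟨a, haS, hdom⟩ := exists_minWeight_word S ⟨i₀, by simp [hS, hi₀]⟩
  have hxa : x (u₀, a) ≠ 0 := by simpa [hS] using haS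
  set M := contract3 (kroneckerTensor (unitTensor ℂ n) (kroneckerPow (cwTensor ℂ 2) N)) x with hM
  have hsub : M.submatrix (fun b : Fin N → Fin 2 => (u₀, fun p => Y (a p) (b p)))
      (fun b' : Fin N → Fin 2 => (u₀, fun p => Z (a p) (b' p))) =
      x (u₀, a) • (1 : Matrix (Fin N → Fin 2) (Fin N → Fin 2) ℂ) := by
    ext b b'
    simp only [hM, Matrix.submatrix_apply, contract3_apply, Matrix.smul_apply, Matrix.one_apply,
      smul_eq_mul, kroneckerTensor_apply, kroneckerPow_apply, unitTensor_apply, and_true]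
    rw [Fintype.sum_prod_type, Finset.sum_eq_single u₀ (fun u _ hu => by simp [hu]) (by simp)]
    simp only [if_true, one_mul]
    rw [Finset.sum_eq_single a ?_ (by simp)]
    · simp_rw [hdiag, Fintype.prod_boole, ← funext_iff]
    · intro i _ hia
      by_cases hxi : x (u₀, i) = 0
      · simp [hxi]
      · obtain ⟨p, hp⟩ := hdom i (by simp [hS, hxi]) hia
        rw [Finset.prod_eq_zero (Finset.mem_univ p) (hkill _ _ hp _ _), mul_zero]
  have hrank1 : (x (u₀, a) • (1 : Matrix (Fin N → Fin 2) (Fin N → Fin 2) ℂ)).rank = 2 ^ N := by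
    rw [Matrix.rank_of_isUnit, Fintype.card_fun, Fintype.card_fin, Fintype.card_fin]
    rw [Matrix.isUnit_iff_isUnit_det, Matrix.det_smul, Matrix.det_one, mul_one]
    exact isUnit_iff_ne_zero.mpr (pow_ne_zero _ hxa)
  calc 2 ^ N = (x (u₀, a) • (1 : Matrix (Fin N → Fin 2) (Fin N → Fin 2) ℂ)).rank := hrank1.symm
    _ = (M.submatrix (fun b : Fin N → Fin 2 => (u₀, fun p => Y (a p) (b p)))
          (fun b' : Fin N → Fin 2 => (u₀, fun p => Z (a p) (b' p)))).rank := by rw [hsub]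
    _ ≤ M.rank := Matrix.rank_submatrix_le _ _ _

/-- Hence **`⟨n⟩ ⊠ cw₂^{⊠N} ∉ 𝓜_r` for `r < 2^N`**. [cite: BlaserIkenmeyerLysikovPandeySchreyer2019, Def. 15] -/
theorem not_mem_minrankSet_unitKronecker_cwTwoPow {n N r : ℕ} (hr : r < 2 ^ N) :
    kroneckerTensor (unitTensor ℂ n) (kroneckerPow (cwTensor ℂ 2) N) ∉
      (minrankSet ℂ r : Set (_ → _ → _ → ℂ)) := by
  rintro ⟨x, hx, hrank⟩
  exact absurd ((two_pow_le_rank_contract3_unitKronecker_cwTwoPow hx).trans hrank) (not_le.mpr hr)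

end CwSide

/-! ## §4  The minrank gap theorem and the rungs -/

section Gap

/-- **Minrank gap.**  For `m < 2^N`, `n', m ≥ 1` and EVERY bijection `e` of the formats, `⟨n⟩ ⊠ cw₂^{⊠N}` does
NOT degenerate (orbit closure) to `e^*(⟨n'⟩ ⊠ ⟨m,m,m⟩)`: both are polystable, so a degeneration is
`w₁ = c • s·w₀` (`exists_smul_sl3_eq_of_degeneratesTo`), and `𝓜_m ∋ w₁` is `ℂˣ × SL³`-invariant while
`w₀ ∉ 𝓜_m`. [cite: KempfNess1979, Thm. 0.2; BlaserIkenmeyerLysikovPandeySchreyer2019, Lemma 18] -/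
theorem unitKronecker_cwTwoPow_not_degeneratesTo_matMul {n N n' m : ℕ} (hn' : 0 < n') (hm : 0 < m)
    (hmN : m < 2 ^ N) (e : (Fin n × (Fin N → Fin 3)) ≃ (Fin n' × (Fin m × Fin m))) :
    ¬ TensorDegeneratesTo (kroneckerTensor (unitTensor ℂ n) (kroneckerPow (cwTensor ℂ 2) N))
      (fun a b c => kroneckerTensor (unitTensor ℂ n') (matMulTensor ℂ m m m) (e a) (e b) (e c)) := by
  classical
  intro hdeg
  haveI : Nonempty (Fin n × (Fin N → Fin 3)) := ⟨e.symm (⟨0, hn'⟩, (⟨0, hm⟩, ⟨0, hm⟩))⟩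
  obtain ⟨c, s, hc, hiso⟩ := exists_smul_sl3_eq_of_degeneratesTo hdeg
    (isPolystableTensor_unitKronecker_cwTwoPow n N)
    (isPolystableTensor_relabel e (isPolystableTensor_unitKronecker_matMul n' m))
    (relabel_unitKronecker_matMul_ne_zero hn' hm e)
  exact not_mem_minrankSet_unitKronecker_cwTwoPow hmN
    (mem_minrankSet_of_eq_smul_actTensor hc s hiso (mem_minrankSet_relabel_unitKronecker_matMul hn' hm e))

/-- **No exchange rung `p/q` with `p < q` has a degeneration witness at any finite level `L ≥ 1`**
(level-`L` tensors in collapsed coordinates: `⟨4^{pL}⟩ ⊠ cw₂^{⊠ qL}` vs `⟨3^{qL}⟩ ⊠ ⟨2^{pL},2^{pL},2^{pL}⟩`,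
any identification of the formats). [cite: KempfNess1979, Thm. 0.2] -/
theorem rung_not_degeneratesTo_of_lt {p q L : ℕ} (hpq : p < q) (hL : 0 < L)
    (e : (Fin (4 ^ (p * L)) × (Fin (q * L) → Fin 3)) ≃
      (Fin (3 ^ (q * L)) × (Fin (2 ^ (p * L)) × Fin (2 ^ (p * L))))) :
    ¬ TensorDegeneratesTo (kroneckerTensor (unitTensor ℂ (4 ^ (p * L))) (kroneckerPow (cwTensor ℂ 2) (q * L)))
      (fun a b c => kroneckerTensor (unitTensor ℂ (3 ^ (q * L)))
        (matMulTensor ℂ (2 ^ (p * L)) (2 ^ (p * L)) (2 ^ (p * L))) (e a) (e b) (e c)) :=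
  unitKronecker_cwTwoPow_not_degeneratesTo_matMul (by positivity) (by positivity)
    (Nat.pow_lt_pow_right (by norm_num) (Nat.mul_lt_mul_of_pos_right hpq hL)) e

/-- **The first open rung `1/2` has no level-one witness** (`⟨4⟩ ⊠ cw₂^{⊠2}` vs `⟨9⟩ ⊠ ⟨2,2,2⟩`, format `36`;
the hand claim of NODE-g32 §3): `m = 2 < 4 = 2^N`. [cite: KempfNess1979, Thm. 0.2] -/
theorem rungHalf_not_degeneratesTo_levelOne (e : (Fin 4 × (Fin 2 → Fin 3)) ≃ (Fin 9 × (Fin 2 × Fin 2))) :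
    ¬ TensorDegeneratesTo (kroneckerTensor (unitTensor ℂ 4) (kroneckerPow (cwTensor ℂ 2) 2))
      (fun a b c => kroneckerTensor (unitTensor ℂ 9) (matMulTensor ℂ 2 2 2) (e a) (e b) (e c)) :=
  unitKronecker_cwTwoPow_not_degeneratesTo_matMul (by norm_num) (by norm_num) (by norm_num) e

/-- Rung `1/2` at level two (`⟨16⟩ ⊠ cw₂^{⊠4}` vs `⟨81⟩ ⊠ ⟨4,4,4⟩`, format `1296`): `m = 4 < 16`.
[cite: KempfNess1979, Thm. 0.2] -/
theorem rungHalf_not_degeneratesTo_levelTwo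
    (e : (Fin 16 × (Fin 4 → Fin 3)) ≃ (Fin 81 × (Fin 4 × Fin 4))) :
    ¬ TensorDegeneratesTo (kroneckerTensor (unitTensor ℂ 16) (kroneckerPow (cwTensor ℂ 2) 4))
      (fun a b c => kroneckerTensor (unitTensor ℂ 81) (matMulTensor ℂ 4 4 4) (e a) (e b) (e c)) :=
  unitKronecker_cwTwoPow_not_degeneratesTo_matMul (by norm_num) (by norm_num) (by norm_num) e

/-- The unit-packed perfection cell `(4, 9 ⊠ ⟨3,3,3⟩)`: `⟨1⟩ ⊠ cw₂^{⊠4} ⋭ e^*(⟨9⟩ ⊠ ⟨3,3,3⟩)` (format `81`;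
`m = 3 < 16`). [cite: KempfNess1979, Thm. 0.2] -/
theorem cellFour_not_degeneratesTo_nineMatMulThree
    (e : (Fin 1 × (Fin 4 → Fin 3)) ≃ (Fin 9 × (Fin 3 × Fin 3))) :
    ¬ TensorDegeneratesTo (kroneckerTensor (unitTensor ℂ 1) (kroneckerPow (cwTensor ℂ 2) 4))
      (fun a b c => kroneckerTensor (unitTensor ℂ 9) (matMulTensor ℂ 3 3 3) (e a) (e b) (e c)) :=
  unitKronecker_cwTwoPow_not_degeneratesTo_matMul (by norm_num) (by norm_num) (by norm_num) e

/-- The exact perfection cells in unit-packed form, `⟨1⟩ ⊠ cw₂^{⊠N} ⋭ e^*(⟨1⟩ ⊠ ⟨m,m,m⟩)` whenever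
`m < 2^N` — which covers every equal-format case `m² = 3^N` (`m = 3^{N/2} < 2^N`), e.g. `(4,9)`, `(6,27)`;
a proof of the `OutsiderSandwichNoPerfectDegeneration` cells that does not use `CwTwoNoExactPerfection`.
[cite: KempfNess1979, Thm. 0.2] -/
theorem cell_not_degeneratesTo_of_sq_eq {N m : ℕ} (h : m * m = 3 ^ N) (hN : 1 ≤ N)
    (e : (Fin 1 × (Fin N → Fin 3)) ≃ (Fin 1 × (Fin m × Fin m))) :
    ¬ TensorDegeneratesTo (kroneckerTensor (unitTensor ℂ 1) (kroneckerPow (cwTensor ℂ 2) N))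
      (fun a b c => kroneckerTensor (unitTensor ℂ 1) (matMulTensor ℂ m m m) (e a) (e b) (e c)) := by
  have hm : 0 < m := by
    rcases Nat.eq_zero_or_pos m with rfl | hm
    · exact absurd h (by positivity)
    · exact hm
  refine unitKronecker_cwTwoPow_not_degeneratesTo_matMul (by norm_num) hm ?_ e
  -- `m² = 3^N < 4^N = (2^N)²`
  have h34 : 3 ^ N < 2 ^ N * 2 ^ N := by
    calc 3 ^ N < 4 ^ N := Nat.pow_lt_pow_left (by norm_num) (by omega)
      _ = (2 * 2) ^ N := by norm_num
      _ = 2 ^ N * 2 ^ N := mul_pow 2 2 N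
  by_contra hcon
  push Not at hcon
  have key : 2 ^ N * 2 ^ N ≤ m * m := Nat.mul_le_mul hcon hcon
  rw [← h] at h34
  exact absurd (lt_of_le_of_lt key h34) (lt_irrefl _)

end Gap

end Summit.MatrixMultiplication.MatrixMultiplication.Theorems.OutsiderSandwichMinrankGap

end
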